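import Mathlib
import HarnessLib
import Summits.Parity.Statement
import Summits.Parity.GeneralizedHardyLittlewood.Theses.SiegelSpectrumSplit

/-!
# Assembly of route-Parity-SiegelSpectrumSplit (item stmt-Parity-25151)

`Assembly : BoundedSiegelZeroQuality → UpperGivenBoundedSiegel → LowerGivenBoundedSiegel → GeneralizedHardyLittlewood` is literally the route's certified deciding theorem `closes`
(node G1 «SiegelSpectrumSplit» (record GHL-side route, decomp-parity lens-5; rev 4)): Q and the two Q-conditioned one-sided halves give the two-sided GHL block (`abs_sub_le_iff`).  One line; no mathematics beyond the route file.
-/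

namespace Summit.Parity.GeneralizedHardyLittlewood.Theses.SiegelSpectrumSplit

/-- Assembly item stmt-Parity-25151 of route-Parity-SiegelSpectrumSplit:
`BoundedSiegelZeroQuality → UpperGivenBoundedSiegel → LowerGivenBoundedSiegel → GeneralizedHardyLittlewood`,
by the route's deciding theorem `closes`. -/
theorem assembly_proof : Assembly :=
  fun h1 h2 h3 => closes h1 h2 h3

end Summit.Parity.GeneralizedHardyLittlewood.Theses.SiegelSpectrumSplit
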